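import Summits.BirchSwinnertonDyer.BirchSwinnertonDyer.Theses.KatoDescentPotSupersingular
import Literature.NumberTheory.EllipticCurves.Jetchev2008.HeegnerPointGlobalDivisibility
import Literature.NumberTheory.EllipticCurves.KolyvaginShaStructureDivisibility
import Literature.NumberTheory.EllipticCurves.MatarNekovar2019.ShaIndexBoundIrreducible
import HarnessLib

/-!
# [ARCHIVE of skeleton v1, superseded by v2 (plan g22) — namespace `.BirthV1`, NOT registered] BC3 BIRTH SKELETON — crux `WildJetchevBoundAtP` (item stmt-BirchSwinnertonDyer-19941; route K9 =
# `Theses/KatoDescentPotSupersingular.lean` rev 21, rank 6; planner bsd-potss-plan g21, 2026-08-27)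

The crux is the `q = p` Heegner-index bound at the ADDITIVE prime itself: for `W/ℚ` globally minimal
non-CM with `r_an = 0`, additive potentially good at an odd `p` with `W[p]` irreducible and the `p`-adic
tower NOT onto, a lattice-optimal datum of level `N` with Manin constant prime to `p`, `K` imaginary
quadratic with `d_K ≠ −3` and the Heegner hypothesis for `N` (so `p ∣ N` splits in `K`), `P` a Heegner
point of level `N` of infinite order: `ord_p #Ш(W/K)[p^∞] + 2·ord_p c_p(W) ≤ 2·ord_p [W(K) : ℤP]`.
It is OUTSIDE Jetchev 2008 (Hypothesis (∗) has `p ∤ N`; his Lemma 4.3 compares the unramified and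
Kummer conditions only at `v ∤ p`) and outside the D-audited reading (item 20165 displays `q ≠ p`):
the route docstring records «needs a NEW ARGUMENT at `v ∣ p`». Evidence: 58 B rows of the O6 census
satisfy it with the BSD-predicted `#Ш` (plan g19, BC7 CLEAN).

THE CUT — the same two halves as Cor. 1.5's printed proof (*"Thm. 1.4 and Kolyvagin's formula"*), at
the additive prime:
* `stub_structure_depth_indexForm_d3` (S1′, size XL): the Kolyvagin–McCallum STRUCTURE half at depth
  `t` under IRREDUCIBLE image in INDEX currency — identical to the stub `stub_structure_depth_indexForm`
  registered on the shared crux `JetchevIrreducibleReadingByName` (Cruxes/JetchevIrreducibleReadingByName/Lines/birth.lean)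
  EXCEPT that only `d_K ≠ −3` is assumed (this crux's binders do not exclude `d_K = −4`; for odd `p`
  the unit index `u_K = 2` of `ℚ(i)` is a `p`-adic unit in Gross's trace normalisation `P_1 = u_K⁻¹·…`,
  so the reading is harmless but it IS a reading: MN19 Thm. 0.3/0.7 print `D_K ≠ −3, −4`). S1′ ⇒ S1.
  SOURCES: MatarNekovar2019 Thm. 0.7 + §0.11, §0.3–0.4; McCallumLMS1991 §5 Lemma 5.1, Cor. 5.6;
  Kolyvagin 1991 LNM 1479 Thm. 1 (F1 primary unread); GrossLMS1991 §3 (u_K). WHY IT MIGHT FAIL: as S1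
  (F1; index reading needs `E(K)[p] = 0`), plus the `d_K = −4` normalisation.
* `stub_derivedPoint_divisible_at_additive_p` (S2′, size XL, conjecture-grade): under the crux's
  binders verbatim, GLOBAL DIVISIBILITY of every derived Heegner point on every frame of level `N` to
  depth `ord_p c_p(W)` — the `q = p` share of Jetchev's **Conjecture 1.3** (`m_∞ = ord_p ∏_{q∣N} c_q`,
  arXiv p. 3 = the BSD formula over `K` rewritten through Gross–Zagier), i.e. exactly what BSD predicts
  and what no printed theorem gives at an additive `v ∣ p` (`c_p ∈ {1,2,3,4}`, so the content is at
  `p = 3`, Kodaira types IV / IV*, `c_3 = 3`: depth 1). SOURCES: Jetchev2008 Conj. 1.3, Thm. 1.4 and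
  §4 (the mechanism to extend: a core vertex whose localisation at `v ∣ p` detects `Φ_v[p]`);
  evidence plan g19 (58 B rows). WHY IT MIGHT FAIL: at additive `v ∣ 3` the Kummer image
  `E(K_v)/3^m` is not `Φ_v`-sized (the special fibre's identity component is unipotent of `3`-power
  order), so the Tamagawa factor need not force extra depth — one B row with `m_∞ = 0 < ord_3 c_3` and
  BSD-consistent `Ш` would not contradict BSD (the depth could come from another `q`) but kills S2′.
`WildJetchevBoundAtP_of` is the literal modus ponens at `t := ord_p c_p`. Two `sorry`s, both in stubs.
-/

noncomputable section

open scoped Classical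

open WeierstrassCurve Literature.NumberTheory.EllipticCurves
open Literature.NumberTheory.EllipticCurves.ModularForms
open Literature.NumberTheory.EllipticCurves.Rank1Residual

namespace Summit.BirchSwinnertonDyer.BirchSwinnertonDyer.Cruxes.WildJetchevBoundAtP.BirthV1

/-- **Global `p`-divisibility of the derived Heegner points to depth `t` on every frame of level `N`**
(McCallum 1991 §5: `M_∞ ≥ t`; Jetchev 2008 §3.1: `m_∞ ≥ t`) — verbatim the interface of the shared
crux's birth skeleton (`Cruxes/JetchevIrreducibleReadingByName/Lines/birth.lean`). -/
def GlobalDivisibilityToDepth (N : ℕ) [NeZero N] (W : WeierstrassCurve ℚ) [W.IsGloballyMinimal]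
    (K : Type) [Field K] [NumberField K] (p t : ℕ) : Prop :=
  ∀ (Dt : ModularParametrizationData W N) (β : ℤ) (ι : K →+* ℂ) (s : ℕ), s ≤ t →
    ∀ (n : ℕ) (d : KolyvaginHeegnerData Dt β ι n), Squarefree n →
      (∀ ℓ ∈ n.primeFactors, Zhang2014.IsKolyvaginPrime N W K p ℓ ∧
        s ≤ Zhang2014.kolyvaginIndex W p ℓ) →
      ∃ Q : (W.baseChange (ringClassField K ι n)).toAffine.Point,
        ((p ^ s : ℕ) : ℤ) • Q = d.derivedPoint

/-- Statement of `stub_structure_depth_indexForm_d3` (S1′): the structure half at depth `t`,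
irreducible image, index currency, `d_K ≠ −3` only. [MatarNekovar2019 Thm. 0.7, §0.11; McCallumLMS1991
§5 Lemma 5.1, Cor. 5.6; Kolyvagin1991 LNM 1479 Thm. 1 (F1); GrossLMS1991 §3] -/
abbrev Sig.stub_structure_depth_indexForm_d3 : Prop :=
  ∀ (N : ℕ) [NeZero N] (W : WeierstrassCurve ℚ) [W.IsElliptic] [W.IsGloballyMinimal]
    (K : Type) [Field K] [NumberField K],
    IsImaginaryQuadratic K → NumberField.discr K ≠ -3 → SatisfiesHeegnerHypothesis N K →
    ∀ (p : ℕ) [Fact p.Prime], p ≠ 2 → ¬ W.HasCM → W.HasIrreducibleModPGaloisRep p →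
    ∀ {P : (W.baseChange K).toAffine.Point}, IsHeegnerPoint N W K P → ¬ IsOfFinAddOrder P →
    ∀ (t : ℕ), GlobalDivisibilityToDepth N W K p t →
    padicValNat p (Nat.card (AddCommGroup.primaryComponent (W.baseChange K).sha p)) + 2 * t ≤
      2 * padicValNat p (AddSubgroup.zmultiples P).index

/-- Statement of `stub_derivedPoint_divisible_at_additive_p` (S2′): global divisibility to depth
`ord_p c_p` at the ADDITIVE prime, under the crux's binders verbatim (conjecture-grade; the `q = p`
share of Jetchev's Conj. 1.3). [Jetchev2008 Conj. 1.3, Thm. 1.4, §4; evidence: plan g19 58 B rows] -/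
abbrev Sig.stub_derivedPoint_divisible_at_additive_p : Prop :=
  ∀ (N : ℕ) [NeZero N] (W : WeierstrassCurve ℚ) [W.IsElliptic] [W.IsGloballyMinimal]
    (K : Type) [Field K] [NumberField K],
    IsImaginaryQuadratic K → NumberField.discr K ≠ -3 → SatisfiesHeegnerHypothesis N K →
    ∀ (p : ℕ) [Fact p.Prime], p ≠ 2 → W.analyticRank = 0 → Addv W p → 0 ≤ padicValRat p W.j →
    ¬ W.HasCM → W.HasIrreducibleModPGaloisRep p →
    ¬ (∀ n : ℕ, W.HasSurjectiveModNGaloisRep (p ^ n : ℕ)) →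
    (∃ Dt : ModularParametrizationData W N,
      (∀ z ∈ Dt.L.lattice, ∃ w ∈ periodLattice Dt.f, z = (Dt.c : ℂ) * w) ∧ ¬ (p : ℤ) ∣ Dt.c) →
    ∀ {P : (W.baseChange K).toAffine.Point}, IsHeegnerPoint N W K P → ¬ IsOfFinAddOrder P →
    p ∣ N →
    GlobalDivisibilityToDepth N W K p
      (padicValNat p ((W.baseChange ℚ_[p]).localTamagawaNumber ℤ_[p]))

/-- S1′ — registered stub. -/
theorem stub_structure_depth_indexForm_d3 : Sig.stub_structure_depth_indexForm_d3 := by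
  sorry

/-- S2′ — registered stub. -/
theorem stub_derivedPoint_divisible_at_additive_p :
    Sig.stub_derivedPoint_divisible_at_additive_p := by
  sorry

/-- **The crux from the two stubs** (structure half at `t = ord_p c_p`, fed by the at-`p`
divisibility), concluding the K9 route decl BY NAME. -/
theorem WildJetchevBoundAtP_of (h₁ : Sig.stub_structure_depth_indexForm_d3)
    (h₂ : Sig.stub_derivedPoint_divisible_at_additive_p) :
    Summit.BirchSwinnertonDyer.BirchSwinnertonDyer.Theses.KatoDescentPotSupersingular.WildJetchevBoundAtP := by
  unfold Summit.BirchSwinnertonDyer.BirchSwinnertonDyer.Theses.KatoDescentPotSupersingular.WildJetchevBoundAtP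
  intro N _ W _ _ K _ _ hK hD3 hH p _ hp2 hr hadd hj hcm hirr hns hopt P hP hnt hpN
  exact h₁ N W K hK hD3 hH p hp2 hcm hirr hP hnt _
    (h₂ N W K hK hD3 hH p hp2 hr hadd hj hcm hirr hns hopt hP hnt hpN)

end Summit.BirchSwinnertonDyer.BirchSwinnertonDyer.Cruxes.WildJetchevBoundAtP.BirthV1

end
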